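import Summits.NavierStokesRegularity.NavierStokesRegularity.Theorems.CriticalSwirlRegularity.Negative.CollapsingDipCalculus

/-!
# The Dirichlet repair does not restore the modulus: a collapsing dip on the rest state

Negative-side support for the crux `CriticalSwirlRegularity` (stmt-NavierStokesRegularity-1253, route
`FlatSwirlGauge`), line `registered` (birth skeleton `Cruxes/CriticalSwirlRegularity/Lines/birth.lean`), by the
line lead (continuation c3, 2026-08-17). Theorems only (no definitions).

The skeleton's load-bearing stub `stub_momentumUniformContinuity` (S2: every axis-like flat swirl gauge has a
momentum `α` UNIFORMLY CONTINUOUS up to the final time) is false on the rest state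
(`stub_momentumUniformContinuity_false`, lead c1), and the typed block carries no maximum principle
(`weakMaximumPrinciple_false_of_isFlatSwirlGaugeOn`, lead c2). Both witnesses put the action ON the degeneracy set
`{d = 0}` (the self-similar momentum `x₂/√(ν(T−t)+‖x‖²)` does not vanish on its axis; the growing maximum sits on
the axis), so the repair proposed to the planners was the DIRICHLET CLAUSE of the exactly-flat model — `Γ = r u_θ = 0`
on the axis —: restate the block with `α = 0` on `{d = 0}` and a genuine distance `d(t,·) = dist(·, Z_t)` (option
"D1"; lead c2 judged it "plausibly restores the rest-state modulus").

This file shows that D1 does NOT restore the modulus (`dirichlet_stub_momentumUniformContinuity_false`): already on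
the rest state `u ≡ 0`, `p ≡ 0`, with the vertex `x₀ = 0` and `d = r = cylRadius` — the distance to a FIXED straight
axis through the vertex (`cylRadius_eq_infDist`), `1`-Lipschitz, locally `1`-thin (`vol({r<δ} ∩ B(y,s)) ≤ 8δ²s`) —
the COLLAPSING DIP
  `α(t,x) = c r²/(λ(t)² + r²) + r²`, `λ(t) = ν(T − t)`, `0 < c ≤ 1`,
is an admissible momentum: `α` is `C²` (indeed smooth) below `T`, `0 ≤ α ≤ c + ρ²` on `B_ρ(0)`, `α = 0` ON THE AXIS
(it even vanishes to second order there, like `Γ`), the vorticity clauses are trivial (`curl 0 = 0`), and with the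
drift `b = ((∂ₜα/ν − Δα)/‖∇α‖²)∇α` the flat transport law holds at every point off the axis with `‖b‖ r ≤ 8`
(indeed `≤ 5/2`; numerically `≈ 2.06`): writing `q = r²`, `den = λ² + q`,
  `∂ₜα = 2cνλq/den²`, `∂ₕα = 2(cλ²/den² + 1)(x₀h₀ + x₁h₁)` (so `‖∇α‖ ≥ 2(cλ²/den² + 1) r`),
  `Δα = 4cλ²(λ² − q)/den³ + 4`, and `|∂ₜα/ν − Δα| ≤ 5(cλ²/den² + 1)`
(`CollapsingDipCalculus`). But `α(t, ·) = c/2 + λ²` on the circle `r = λ(t) → 0` while `α(t, 0) = 0`: the dip of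
width `λ(t)` collapses onto the axis and `α(t,·) → c·1_{r>0} + r²`, so `α` is NOT uniformly continuous on any
`Q_{ρ₂}(T, 0)` (`not_uniformlyContinuous_collapsingDip`).

Information for the planners (why D1 fails and what survives). The obstruction is not the size of the drift but
its DIRECTION: in the zone `λ ≪ r ≪ √λ` the witness' drift is `≈ +(2/r) e_r` (outward), under which `α` diffuses like
a radial function in dimension `4`, the axis has zero capacity, the Dirichlet datum is invisible and a dip of width
`λ(t) = ν(T−t)` (collapsing FASTER than the parabolic scale, at bounded cost `λλ'/ν = λ`) is admissible; the
exactly-flat drift `−(2/r) e_r` (inward, `Δ − (2/r)∂ᵣ`: "dimension `0`", `Γ/r²` is `5`-D caloric) is regularising for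
the opposite reason. A bound `‖b‖ d ≤ C₀` cannot tell the two apart. Hence, of the restatement options recorded on
this crux, D1 (Dirichlet trace + distance-like `d`) is dead on arrival for any "a-priori modulus" architecture; what
survives is D2 (STRUCTURAL flatness: `b = −2∇w/w`, `w ≍ d`, i.e. the divergence form `w² div(w⁻² ∇α)`), or D3 (re-cut
through a Type-I rate, crux `FlatGaugeExcludesTypeI`). Any future modulus-type stub should be tested against the
three rest-state witnesses `restState_axisGauge` (c1), `growingMomentum_isFlatSwirlGaugeOn` (c2) and
`restState_dirichletAxisGauge` (this file).
-/

noncomputable section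

namespace Summit.NavierStokesRegularity.NavierStokesRegularity.Theorems.CriticalSwirlRegularity.Negative

open MeasureTheory Filter Set Metric Real InnerProductSpace WithLp
open scoped RealInnerProductSpace Laplacian
open Literature.Analysis.FluidPDE

/-! ### The pointwise clauses of the gauge block for the collapsing dip -/

/-- **Gradient lower bound**: along the horizontal vector `(x₀, x₁, 0)` (of norm `r`) the slice has slope
`2(cλ²/den² + 1) r²`, whence `2(cλ²/den² + 1) r² ≤ ‖∇a(x)‖ r`. [folklore] -/
theorem dipSlice_gradient_lower (c : ℝ) {lam : ℝ} (hlam : lam ≠ 0) (hc : 0 ≤ c) (x : EuclideanSpace ℝ (Fin 3)) :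
    2 * (c * lam ^ 2 / (lam ^ 2 + (x 0 ^ 2 + x 1 ^ 2)) ^ 2 + 1) * (x 0 ^ 2 + x 1 ^ 2) ≤
      ‖gradient (fun y : EuclideanSpace ℝ (Fin 3) =>
          c * ((y 0 ^ 2 + y 1 ^ 2) / (lam ^ 2 + (y 0 ^ 2 + y 1 ^ 2))) + (y 0 ^ 2 + y 1 ^ 2)) x‖ * cylRadius x := by
  obtain ⟨hvn, -, -⟩ := horizontal_vector_facts x
  have h := abs_fderiv_le_norm_gradient_mul
    (fun y : EuclideanSpace ℝ (Fin 3) => c * ((y 0 ^ 2 + y 1 ^ 2) / (lam ^ 2 + (y 0 ^ 2 + y 1 ^ 2))) + (y 0 ^ 2 + y 1 ^ 2))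
    x (EuclideanSpace.single (0 : Fin 3) (x 0) + EuclideanSpace.single (1 : Fin 3) (x 1))
  rw [hvn, fderiv_dipSlice_apply c hlam] at h
  have hxx : x 0 * (EuclideanSpace.single (0 : Fin 3) (x 0) + EuclideanSpace.single (1 : Fin 3) (x 1)) 0 +
      x 1 * (EuclideanSpace.single (0 : Fin 3) (x 0) + EuclideanSpace.single (1 : Fin 3) (x 1)) 1 =
      x 0 ^ 2 + x 1 ^ 2 := by
    simp; ring
  have hnn : 0 ≤ 2 * (c * lam ^ 2 / (lam ^ 2 + (x 0 ^ 2 + x 1 ^ 2)) ^ 2 + 1) * (x 0 ^ 2 + x 1 ^ 2) := by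
    positivity
  rwa [hxx, abs_of_nonneg hnn] at h

/-- **Values of the slice**: `0 ≤ a(x) ≤ c + ρ²` for `‖x‖ < ρ`, `0 ≤ c` (`0 ≤ q/den ≤ 1`, `q = r² ≤ ‖x‖²`). [folklore] -/
theorem dipSlice_value_bounds {c lam ρ : ℝ} (hlam : lam ≠ 0) (hc : 0 ≤ c) {x : EuclideanSpace ℝ (Fin 3)}
    (hx : ‖x‖ < ρ) :
    0 ≤ c * ((x 0 ^ 2 + x 1 ^ 2) / (lam ^ 2 + (x 0 ^ 2 + x 1 ^ 2))) + (x 0 ^ 2 + x 1 ^ 2) ∧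
      c * ((x 0 ^ 2 + x 1 ^ 2) / (lam ^ 2 + (x 0 ^ 2 + x 1 ^ 2))) + (x 0 ^ 2 + x 1 ^ 2) ≤ c + ρ ^ 2 := by
  have hq : x 0 ^ 2 + x 1 ^ 2 = cylRadius x ^ 2 := (cylRadius_sq x).symm
  have hlam2 : 0 < lam ^ 2 := by positivity
  have hq0 : 0 ≤ x 0 ^ 2 + x 1 ^ 2 := by positivity
  have hden : 0 < lam ^ 2 + (x 0 ^ 2 + x 1 ^ 2) := by positivity
  have hqρ : x 0 ^ 2 + x 1 ^ 2 < ρ ^ 2 := by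
    rw [hq]
    have h1 : cylRadius x ≤ ‖x‖ := cylRadius_le_norm x
    have h2 : 0 ≤ cylRadius x := cylRadius_nonneg x
    nlinarith [norm_nonneg x]
  have hquot1 : (x 0 ^ 2 + x 1 ^ 2) / (lam ^ 2 + (x 0 ^ 2 + x 1 ^ 2)) ≤ 1 := by
    rw [div_le_one hden]; linarith
  refine ⟨by positivity, ?_⟩
  have : c * ((x 0 ^ 2 + x 1 ^ 2) / (lam ^ 2 + (x 0 ^ 2 + x 1 ^ 2))) ≤ c := by nlinarith
  linarith

/-- **The drift numerator at an admissible point**: with `D = ∂ₜα(t,x)`, `L = Δα(t,·)(x)`, `λ = ν(T−t) > 0`: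
`|D/ν − L| ≤ (11/2)(cλ²/den² + 1)` (indeed `≤ 5(…)`), for `0 ≤ c ≤ 1`. [folklore] -/
theorem dip_drift_numerator_le {c ν T t : ℝ} (hc0 : 0 ≤ c) (hc1 : c ≤ 1) (hν : 0 < ν) (ht : t < T)
    (x : EuclideanSpace ℝ (Fin 3)) :
    |deriv (fun s : ℝ => c * ((x 0 ^ 2 + x 1 ^ 2) / ((ν * (T - s)) ^ 2 + (x 0 ^ 2 + x 1 ^ 2))) +
          (x 0 ^ 2 + x 1 ^ 2)) t / ν -
        (Δ (fun y : EuclideanSpace ℝ (Fin 3) =>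
          c * ((y 0 ^ 2 + y 1 ^ 2) / ((ν * (T - t)) ^ 2 + (y 0 ^ 2 + y 1 ^ 2))) + (y 0 ^ 2 + y 1 ^ 2))) x| ≤
      11 / 2 * (c * (ν * (T - t)) ^ 2 / ((ν * (T - t)) ^ 2 + (x 0 ^ 2 + x 1 ^ 2)) ^ 2 + 1) := by
  set lam : ℝ := ν * (T - t) with hlam_def
  have hlam : 0 < lam := mul_pos hν (by linarith)
  set q : ℝ := x 0 ^ 2 + x 1 ^ 2 with hq_def
  have hq0 : 0 ≤ q := by positivity
  have hden : 0 < lam ^ 2 + q := by positivity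
  have hD : deriv (fun s : ℝ => c * (q / ((ν * (T - s)) ^ 2 + q)) + q) t =
      2 * c * ν * lam * q / (lam ^ 2 + q) ^ 2 :=
    (hasDerivAt_dipMomentum_time (c := c) hden).deriv
  rw [hD, laplacian_dipSlice c hlam.ne' x]
  have he : 2 * c * ν * lam * q / (lam ^ 2 + q) ^ 2 / ν = 2 * c * lam * q / (lam ^ 2 + q) ^ 2 := by
    field_simp
  rw [he]
  have h5 := dip_numerator_abs_le (c := c) hlam hq0 hc0 hc1
  have hm : 0 ≤ c * lam ^ 2 / (lam ^ 2 + q) ^ 2 + 1 := by positivity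
  linarith only [h5, hm]

/-- **The pointwise clauses.** For `ν > 0`, `0 < c ≤ 1`, an admissible time `t < T` and a point `x` with
`‖x‖ < ρ`, the slice `F = α(t,·)` of the collapsing dip, its time derivative `D = ∂ₜα(t,x)` and the drift
`b = ((D/ν − ΔF(x))/‖∇F(x)‖²) ∇F(x)` satisfy: `|F x| ≤ c + ρ²`, the (trivial) vorticity clauses of the rest state,
`‖b‖ r ≤ 8` and the flat transport law `D = ν(ΔF(x) + ⟪b, ∇F(x)⟫)` wherever `r = cylRadius x > 0`. [folklore] -/
theorem collapsingDip_pointwise {c ν T ρ t : ℝ} (hc0 : 0 < c) (hc1 : c ≤ 1) (hν : 0 < ν) (ht : t < T)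
    {x : EuclideanSpace ℝ (Fin 3)} (hx : ‖x‖ < ρ) :
    |c * ((x 0 ^ 2 + x 1 ^ 2) / ((ν * (T - t)) ^ 2 + (x 0 ^ 2 + x 1 ^ 2))) + (x 0 ^ 2 + x 1 ^ 2)| ≤ c + ρ ^ 2 ∧
      ⟪curl (0 : EuclideanSpace ℝ (Fin 3) → EuclideanSpace ℝ (Fin 3)) x,
        gradient (fun y : EuclideanSpace ℝ (Fin 3) =>
          c * ((y 0 ^ 2 + y 1 ^ 2) / ((ν * (T - t)) ^ 2 + (y 0 ^ 2 + y 1 ^ 2))) + (y 0 ^ 2 + y 1 ^ 2)) x⟫ = 0 ∧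
      (0 < cylRadius x →
        ‖curl (0 : EuclideanSpace ℝ (Fin 3) → EuclideanSpace ℝ (Fin 3)) x‖ * cylRadius x ≤
            8 * ‖gradient (fun y : EuclideanSpace ℝ (Fin 3) =>
              c * ((y 0 ^ 2 + y 1 ^ 2) / ((ν * (T - t)) ^ 2 + (y 0 ^ 2 + y 1 ^ 2))) + (y 0 ^ 2 + y 1 ^ 2)) x‖ ∧
          ‖((deriv (fun s : ℝ => c * ((x 0 ^ 2 + x 1 ^ 2) / ((ν * (T - s)) ^ 2 + (x 0 ^ 2 + x 1 ^ 2))) +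
                (x 0 ^ 2 + x 1 ^ 2)) t / ν -
              (Δ (fun y : EuclideanSpace ℝ (Fin 3) =>
                c * ((y 0 ^ 2 + y 1 ^ 2) / ((ν * (T - t)) ^ 2 + (y 0 ^ 2 + y 1 ^ 2))) + (y 0 ^ 2 + y 1 ^ 2))) x) /
              ‖gradient (fun y : EuclideanSpace ℝ (Fin 3) =>
                c * ((y 0 ^ 2 + y 1 ^ 2) / ((ν * (T - t)) ^ 2 + (y 0 ^ 2 + y 1 ^ 2))) + (y 0 ^ 2 + y 1 ^ 2)) x‖ ^ 2) •
              gradient (fun y : EuclideanSpace ℝ (Fin 3) =>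
                c * ((y 0 ^ 2 + y 1 ^ 2) / ((ν * (T - t)) ^ 2 + (y 0 ^ 2 + y 1 ^ 2))) + (y 0 ^ 2 + y 1 ^ 2)) x‖ *
            cylRadius x ≤ 8 ∧
          deriv (fun s : ℝ => c * ((x 0 ^ 2 + x 1 ^ 2) / ((ν * (T - s)) ^ 2 + (x 0 ^ 2 + x 1 ^ 2))) +
              (x 0 ^ 2 + x 1 ^ 2)) t +
            convect (0 : EuclideanSpace ℝ (Fin 3) → EuclideanSpace ℝ (Fin 3))
              (fun y : EuclideanSpace ℝ (Fin 3) =>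
                c * ((y 0 ^ 2 + y 1 ^ 2) / ((ν * (T - t)) ^ 2 + (y 0 ^ 2 + y 1 ^ 2))) + (y 0 ^ 2 + y 1 ^ 2)) x =
          ν * ((Δ (fun y : EuclideanSpace ℝ (Fin 3) =>
                c * ((y 0 ^ 2 + y 1 ^ 2) / ((ν * (T - t)) ^ 2 + (y 0 ^ 2 + y 1 ^ 2))) + (y 0 ^ 2 + y 1 ^ 2))) x +
            ⟪((deriv (fun s : ℝ => c * ((x 0 ^ 2 + x 1 ^ 2) / ((ν * (T - s)) ^ 2 + (x 0 ^ 2 + x 1 ^ 2))) +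
                  (x 0 ^ 2 + x 1 ^ 2)) t / ν -
                (Δ (fun y : EuclideanSpace ℝ (Fin 3) =>
                  c * ((y 0 ^ 2 + y 1 ^ 2) / ((ν * (T - t)) ^ 2 + (y 0 ^ 2 + y 1 ^ 2))) + (y 0 ^ 2 + y 1 ^ 2))) x) /
                ‖gradient (fun y : EuclideanSpace ℝ (Fin 3) =>
                  c * ((y 0 ^ 2 + y 1 ^ 2) / ((ν * (T - t)) ^ 2 + (y 0 ^ 2 + y 1 ^ 2))) + (y 0 ^ 2 + y 1 ^ 2)) x‖ ^ 2) •
                gradient (fun y : EuclideanSpace ℝ (Fin 3) =>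
                  c * ((y 0 ^ 2 + y 1 ^ 2) / ((ν * (T - t)) ^ 2 + (y 0 ^ 2 + y 1 ^ 2))) + (y 0 ^ 2 + y 1 ^ 2)) x,
              gradient (fun y : EuclideanSpace ℝ (Fin 3) =>
                c * ((y 0 ^ 2 + y 1 ^ 2) / ((ν * (T - t)) ^ 2 + (y 0 ^ 2 + y 1 ^ 2))) + (y 0 ^ 2 + y 1 ^ 2)) x⟫)) := by
  have hlam : 0 < ν * (T - t) := mul_pos hν (by linarith)
  -- the four ingredients
  have hval := dipSlice_value_bounds (c := c) (lam := ν * (T - t)) (ρ := ρ) hlam.ne' hc0.le hx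
  have hdir := dipSlice_gradient_lower c hlam.ne' hc0.le x
  have hE := dip_drift_numerator_le hc0.le hc1 hν ht x
  have hq : x 0 ^ 2 + x 1 ^ 2 = cylRadius x ^ 2 := (cylRadius_sq x).symm
  -- generalize the big terms
  generalize gradient (fun y : EuclideanSpace ℝ (Fin 3) =>
      c * ((y 0 ^ 2 + y 1 ^ 2) / ((ν * (T - t)) ^ 2 + (y 0 ^ 2 + y 1 ^ 2))) + (y 0 ^ 2 + y 1 ^ 2)) x = g at hdir ⊢
  generalize deriv (fun s : ℝ => c * ((x 0 ^ 2 + x 1 ^ 2) / ((ν * (T - s)) ^ 2 + (x 0 ^ 2 + x 1 ^ 2))) +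
      (x 0 ^ 2 + x 1 ^ 2)) t = D at hE ⊢
  generalize (Δ (fun y : EuclideanSpace ℝ (Fin 3) =>
      c * ((y 0 ^ 2 + y 1 ^ 2) / ((ν * (T - t)) ^ 2 + (y 0 ^ 2 + y 1 ^ 2))) + (y 0 ^ 2 + y 1 ^ 2))) x = L at hE ⊢
  generalize hm : c * (ν * (T - t)) ^ 2 / ((ν * (T - t)) ^ 2 + (x 0 ^ 2 + x 1 ^ 2)) ^ 2 + 1 = m' at hdir hE
  have hm' : 0 < m' := by rw [← hm]; positivity
  rw [hq] at hdir
  -- assemble the three clauses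
  rw [convect_zero_field, add_zero, curl_zero, inner_zero_left, norm_zero, zero_mul]
  refine ⟨abs_le.2 ⟨by linarith only [hval.1, hc0, sq_nonneg ρ], hval.2⟩, rfl,
    fun hr => ⟨by positivity, ?_, ?_⟩⟩
  · -- `‖b‖ r ≤ 8`
    have hgl : m' * cylRadius x ≤ ‖g‖ := by
      have h3 : m' * cylRadius x * cylRadius x ≤ ‖g‖ * cylRadius x := by
        have h0 : 0 ≤ m' * cylRadius x ^ 2 := by positivity
        nlinarith only [hdir, h0]
      exact le_of_mul_le_mul_right h3 hr
    exact norm_drift_mul_le hr.le hE hgl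
  · -- the transport law (`∇F(x) ≠ 0` off the axis, so the algebra applies)
    refine transport_algebra hν.ne' fun hg0 => ?_
    exfalso
    rw [hg0, norm_zero, zero_mul] at hdir
    have hpos : 0 < 2 * m' * cylRadius x ^ 2 := by positivity
    linarith only [hdir, hpos]

/-! ### The witness: a Dirichlet, distance-like, locally-thin flat swirl gauge on the rest state -/

/-- **The witness.** On the rest state `u ≡ 0` (any `ν > 0`, `0 < ρ`, `ρ² < T`, `0 < c ≤ 1`, vertex `x₀ = 0`) the
collapsing dip `α(t,x) = c r²/((ν(T−t))² + r²) + r²`, the degeneracy function `d = cylRadius` and the drift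
`b = ((∂ₜα/ν − Δα)/‖∇α‖²)∇α` satisfy every clause of the LOCALLY-THIN flat swirl gauge block of
`stub_momentumUniformContinuity` with `C₀ = 8`, `M = c + ρ²`, AND the Dirichlet clauses: `0 ≤ α`, `α = 0` wherever
`d = 0` (module docstring for the computation). [folklore] -/
theorem restState_dirichletAxisGauge {c ν T ρ : ℝ} (hc0 : 0 < c) (hc1 : c ≤ 1) (hν : 0 < ν) (hρ : 0 < ρ)
    (hρT : ρ ^ 2 < T) :
    ∃ b : ℝ → EuclideanSpace ℝ (Fin 3) → EuclideanSpace ℝ (Fin 3),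
      (0 < ρ ∧ ρ ^ 2 < T ∧
        ContDiffOn ℝ 2
          (Function.uncurry fun (t : ℝ) (y : EuclideanSpace ℝ (Fin 3)) =>
            c * ((y 0 ^ 2 + y 1 ^ 2) / ((ν * (T - t)) ^ 2 + (y 0 ^ 2 + y 1 ^ 2))) + (y 0 ^ 2 + y 1 ^ 2))
          (Set.Ioo (T - ρ ^ 2) T ×ˢ Metric.ball (0 : EuclideanSpace ℝ (Fin 3)) ρ) ∧
        (∀ t ∈ Set.Ioo (T - ρ ^ 2) T, ∀ (y : EuclideanSpace ℝ (Fin 3)) (s : ℝ), 0 < s →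
          Metric.ball y s ⊆ Metric.ball (0 : EuclideanSpace ℝ (Fin 3)) ρ →
          ∀ δ ∈ Set.Ioo 0 s, MeasureTheory.volume ({x : EuclideanSpace ℝ (Fin 3) | cylRadius x < δ} ∩
            Metric.ball y s) ≤ ENNReal.ofReal (8 * δ ^ 2 * s)) ∧
        (∀ t ∈ Set.Ioo (T - ρ ^ 2) T, ∀ x ∈ Metric.ball (0 : EuclideanSpace ℝ (Fin 3)) ρ,
          |c * ((x 0 ^ 2 + x 1 ^ 2) / ((ν * (T - t)) ^ 2 + (x 0 ^ 2 + x 1 ^ 2))) + (x 0 ^ 2 + x 1 ^ 2)| ≤ c + ρ ^ 2 ∧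
          ⟪curl (0 : EuclideanSpace ℝ (Fin 3) → EuclideanSpace ℝ (Fin 3)) x,
            gradient (fun y : EuclideanSpace ℝ (Fin 3) =>
              c * ((y 0 ^ 2 + y 1 ^ 2) / ((ν * (T - t)) ^ 2 + (y 0 ^ 2 + y 1 ^ 2))) + (y 0 ^ 2 + y 1 ^ 2)) x⟫ = 0 ∧
          (0 < cylRadius x →
            ‖curl (0 : EuclideanSpace ℝ (Fin 3) → EuclideanSpace ℝ (Fin 3)) x‖ * cylRadius x ≤
                8 * ‖gradient (fun y : EuclideanSpace ℝ (Fin 3) =>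
                  c * ((y 0 ^ 2 + y 1 ^ 2) / ((ν * (T - t)) ^ 2 + (y 0 ^ 2 + y 1 ^ 2))) + (y 0 ^ 2 + y 1 ^ 2)) x‖ ∧
              ‖b t x‖ * cylRadius x ≤ 8 ∧
              deriv (fun s : ℝ => c * ((x 0 ^ 2 + x 1 ^ 2) / ((ν * (T - s)) ^ 2 + (x 0 ^ 2 + x 1 ^ 2))) +
                  (x 0 ^ 2 + x 1 ^ 2)) t +
                convect (0 : EuclideanSpace ℝ (Fin 3) → EuclideanSpace ℝ (Fin 3))
                  (fun y : EuclideanSpace ℝ (Fin 3) =>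
                    c * ((y 0 ^ 2 + y 1 ^ 2) / ((ν * (T - t)) ^ 2 + (y 0 ^ 2 + y 1 ^ 2))) + (y 0 ^ 2 + y 1 ^ 2)) x =
              ν * ((Δ (fun y : EuclideanSpace ℝ (Fin 3) =>
                    c * ((y 0 ^ 2 + y 1 ^ 2) / ((ν * (T - t)) ^ 2 + (y 0 ^ 2 + y 1 ^ 2))) + (y 0 ^ 2 + y 1 ^ 2))) x +
                ⟪b t x, gradient (fun y : EuclideanSpace ℝ (Fin 3) =>
                  c * ((y 0 ^ 2 + y 1 ^ 2) / ((ν * (T - t)) ^ 2 + (y 0 ^ 2 + y 1 ^ 2))) + (y 0 ^ 2 + y 1 ^ 2)) x⟫)))) ∧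
      (∀ (t : ℝ) (x : EuclideanSpace ℝ (Fin 3)),
        0 ≤ c * ((x 0 ^ 2 + x 1 ^ 2) / ((ν * (T - t)) ^ 2 + (x 0 ^ 2 + x 1 ^ 2))) + (x 0 ^ 2 + x 1 ^ 2) ∧
        (cylRadius x = 0 →
          c * ((x 0 ^ 2 + x 1 ^ 2) / ((ν * (T - t)) ^ 2 + (x 0 ^ 2 + x 1 ^ 2))) + (x 0 ^ 2 + x 1 ^ 2) = 0)) := by
  refine ⟨fun t x =>
    ((deriv (fun s : ℝ => c * ((x 0 ^ 2 + x 1 ^ 2) / ((ν * (T - s)) ^ 2 + (x 0 ^ 2 + x 1 ^ 2))) +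
          (x 0 ^ 2 + x 1 ^ 2)) t / ν -
        (Δ (fun y : EuclideanSpace ℝ (Fin 3) =>
          c * ((y 0 ^ 2 + y 1 ^ 2) / ((ν * (T - t)) ^ 2 + (y 0 ^ 2 + y 1 ^ 2))) + (y 0 ^ 2 + y 1 ^ 2))) x) /
      ‖gradient (fun y : EuclideanSpace ℝ (Fin 3) =>
        c * ((y 0 ^ 2 + y 1 ^ 2) / ((ν * (T - t)) ^ 2 + (y 0 ^ 2 + y 1 ^ 2))) + (y 0 ^ 2 + y 1 ^ 2)) x‖ ^ 2) •
      gradient (fun y : EuclideanSpace ℝ (Fin 3) =>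
        c * ((y 0 ^ 2 + y 1 ^ 2) / ((ν * (T - t)) ^ 2 + (y 0 ^ 2 + y 1 ^ 2))) + (y 0 ^ 2 + y 1 ^ 2)) x,
    ⟨hρ, hρT, contDiffOn_dipMomentum c hν,
      fun t _ y s _ _ δ hδ => volume_cylRadius_lt_inter_ball_le y s hδ.1.le, fun t ht x hx => ?_⟩,
    fun t x => ?_⟩
  · rw [Set.mem_Ioo] at ht
    rw [Metric.mem_ball, dist_zero_right] at hx
    exact collapsingDip_pointwise hc0 hc1 hν ht.2 hx
  · have hq0 : 0 ≤ x 0 ^ 2 + x 1 ^ 2 := by positivity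
    refine ⟨by positivity, fun hr => ?_⟩
    obtain ⟨h0, h1⟩ := (cylRadius_eq_zero_iff x).1 hr
    simp [h0, h1]

/-- **The collapsing dip is a typed flat swirl gauge** (`IsFlatSwirlGaugeOn`, global thinness clause) on the rest
state, with `C₀ = 8`, `M = c + ρ²`, `d = cylRadius`. [folklore] -/
theorem collapsingDip_isFlatSwirlGaugeOn {c ν T ρ : ℝ} (hc0 : 0 < c) (hc1 : c ≤ 1) (hν : 0 < ν) (hρ : 0 < ρ)
    (hρT : ρ ^ 2 < T) :
    ∃ b : ℝ → EuclideanSpace ℝ (Fin 3) → EuclideanSpace ℝ (Fin 3),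
      IsFlatSwirlGaugeOn ν 0 T 0 ρ 8 (c + ρ ^ 2)
        (fun t y => c * ((y 0 ^ 2 + y 1 ^ 2) / ((ν * (T - t)) ^ 2 + (y 0 ^ 2 + y 1 ^ 2))) + (y 0 ^ 2 + y 1 ^ 2))
        b (fun _ x => cylRadius x) := by
  obtain ⟨b, ⟨-, -, hcd, hthin, hpt⟩, -⟩ := restState_dirichletAxisGauge hc0 hc1 hν hρ hρT
  refine ⟨b, hρ, hρT, hcd, fun t ht δ hδ => ?_, fun t ht x hx => hpt t ht x hx⟩
  exact hthin t ht 0 ρ hρ subset_rfl δ hδ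

/-! ### No modulus at the vertex -/

/-- **No modulus at the vertex.** The collapsing dip is NOT uniformly continuous on any backward cylinder
`Q_{ρ₂}(T,0)`: for `ε = c/4` and any `η > 0`, at the time `t = T − μ` (`νμ = ℓ ≤ min η (ρ₂/2)`) the points
`x = ℓ e₀` (on the circle `r = λ(t) = ℓ`) and `y = 0` have `|α(t,x) − α(t,y)| = c/2 + ℓ² > c/4`. [folklore] -/
theorem not_uniformlyContinuous_collapsingDip {c ν T ρ : ℝ} (hc : 0 < c) (hν : 0 < ν) :
    ¬ (∃ ρ₂ : ℝ, 0 < ρ₂ ∧ ρ₂ ≤ ρ ∧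
      (∀ ε : ℝ, 0 < ε → ∃ η : ℝ, 0 < η ∧
        ∀ t ∈ Set.Ioo (T - ρ₂ ^ 2) T, ∀ s ∈ Set.Ioo (T - ρ₂ ^ 2) T,
          ∀ x ∈ Metric.ball (0 : EuclideanSpace ℝ (Fin 3)) ρ₂, ∀ y ∈ Metric.ball (0 : EuclideanSpace ℝ (Fin 3)) ρ₂,
            |t - s| ≤ η → dist x y ≤ η →
              |(c * ((x 0 ^ 2 + x 1 ^ 2) / ((ν * (T - t)) ^ 2 + (x 0 ^ 2 + x 1 ^ 2))) + (x 0 ^ 2 + x 1 ^ 2)) -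
                (c * ((y 0 ^ 2 + y 1 ^ 2) / ((ν * (T - s)) ^ 2 + (y 0 ^ 2 + y 1 ^ 2))) + (y 0 ^ 2 + y 1 ^ 2))| ≤
                ε)) := by
  rintro ⟨ρ₂, hρ₂, -, H⟩
  obtain ⟨η, hη, H⟩ := H (c / 4) (by positivity)
  set lam : ℝ := min η (ρ₂ / 2) with hlam_def
  have hlam : 0 < lam := lt_min hη (by linarith)
  have hlamη : lam ≤ η := min_le_left _ _
  have hlamρ : lam < ρ₂ := (min_le_right _ _).trans_lt (by linarith)
  set μ : ℝ := min (ρ₂ ^ 2 / 2) (lam / ν) with hμ_def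
  have hμ : 0 < μ := lt_min (by positivity) (by positivity)
  have hμρ : μ < ρ₂ ^ 2 := (min_le_left _ _).trans_lt (by nlinarith)
  set ℓ : ℝ := ν * μ with hℓ_def
  have hℓ : 0 < ℓ := mul_pos hν hμ
  have hℓlam : ℓ ≤ lam := by
    have := min_le_right (ρ₂ ^ 2 / 2) (lam / ν)
    rw [← hμ_def] at this
    calc ℓ = ν * μ := rfl
      _ ≤ ν * (lam / ν) := mul_le_mul_of_nonneg_left this hν.le
      _ = lam := by field_simp
  have ht : T - μ ∈ Set.Ioo (T - ρ₂ ^ 2) T := ⟨by linarith, by linarith⟩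
  set x : EuclideanSpace ℝ (Fin 3) := EuclideanSpace.single (0 : Fin 3) ℓ with hx_def
  have hxn : ‖x‖ = ℓ := by
    rw [hx_def, EuclideanSpace.norm_eq]
    simp [Real.sqrt_sq hℓ.le]
  have hx : x ∈ Metric.ball (0 : EuclideanSpace ℝ (Fin 3)) ρ₂ := by
    rw [Metric.mem_ball, dist_zero_right, hxn]; linarith
  have h := H (T - μ) ht (T - μ) ht x hx 0 (Metric.mem_ball_self hρ₂) (by simp [hη.le])
    (by rw [dist_zero_right, hxn]; linarith)
  have hx0 : x 0 = ℓ := by simp [hx_def]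
  have hx1 : x 1 = 0 := by simp [hx_def]
  rw [hx0, hx1] at h
  simp only [PiLp.zero_apply, sub_sub_cancel] at h
  rw [← hℓ_def] at h
  have hℓ2 : 0 < ℓ ^ 2 := by positivity
  have hval : c * ((ℓ ^ 2 + (0 : ℝ) ^ 2) / (ℓ ^ 2 + (ℓ ^ 2 + (0 : ℝ) ^ 2))) + (ℓ ^ 2 + (0 : ℝ) ^ 2) -
      (c * (((0 : ℝ) ^ 2 + (0 : ℝ) ^ 2) / (ℓ ^ 2 + ((0 : ℝ) ^ 2 + (0 : ℝ) ^ 2))) + ((0 : ℝ) ^ 2 + (0 : ℝ) ^ 2)) =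
      c / 2 + ℓ ^ 2 := by
    field_simp
    ring
  rw [hval, abs_of_pos (by positivity)] at h
  linarith

/-! ### Hence: the Dirichlet repair of `stub_momentumUniformContinuity` is false -/

/-- **The Dirichlet (D1) repair of `stub_momentumUniformContinuity` is false.** Strengthen the hypotheses of the
registered stub (locally-thin flat swirl gauge block, verbatim) by the Dirichlet clauses of the exactly-flat model:
`0 ≤ α`, `α = 0` wherever `d = 0`, `α` smooth (`C^∞`) below `T`; `d ≥ 0`, `d(t,·)` equal to the distance to its own
zero set (a genuine distance function to the degeneracy set `Z_t = {d(t,·) = 0}`), that zero set being the FIXED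
straight line through the vertex `x₀` parallel to `e₂`, `d` independent of `t`, vanishing at `x₀`, and `1`-Lipschitz. The conclusion (uniform continuity of `α` on some `Q_{ρ₂}(T,x₀)`) still fails: witness the rest
state `u ≡ 0`, `p ≡ 0`, `ν = 1`, `T = 2`, `ρ = 1`, `x₀ = 0`, `C₀ = 8`, `M = 2`, the collapsing dip
`α(t,x) = r²/((2−t)² + r²) + r²`, `d = cylRadius` and the drift of `restState_dirichletAxisGauge`
(`not_uniformlyContinuous_collapsingDip`). [folklore] -/
theorem dirichlet_stub_momentumUniformContinuity_false :
    ¬ (∀ (ν T : ℝ), 0 < ν → 0 < T →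
      ∀ (u : ℝ → EuclideanSpace ℝ (Fin 3) → EuclideanSpace ℝ (Fin 3)) (p : ℝ → EuclideanSpace ℝ (Fin 3) → ℝ),
        Literature.Analysis.FluidPDE.IsClassicalNSSolutionOn (Set.Ico 0 T) ν 0 u p →
        Literature.Analysis.FluidPDE.IsLerayHopfOn T ν 0 (u 0) u →
        Literature.Analysis.FluidPDE.HasRapidSpatialDecay (u 0) →
      ∀ (x₀ : EuclideanSpace ℝ (Fin 3)) (ρ C₀ M : ℝ) (α : ℝ → EuclideanSpace ℝ (Fin 3) → ℝ)
        (b : ℝ → EuclideanSpace ℝ (Fin 3) → EuclideanSpace ℝ (Fin 3)) (d : ℝ → EuclideanSpace ℝ (Fin 3) → ℝ),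
        (0 < ρ ∧ ρ ^ 2 < T ∧ ContDiffOn ℝ 2 (Function.uncurry α) (Set.Ioo (T - ρ ^ 2) T ×ˢ Metric.ball x₀ ρ) ∧
          (∀ t ∈ Set.Ioo (T - ρ ^ 2) T, ∀ (y : EuclideanSpace ℝ (Fin 3)) (s : ℝ), 0 < s →
            Metric.ball y s ⊆ Metric.ball x₀ ρ →
            ∀ δ ∈ Set.Ioo 0 s, MeasureTheory.volume ({x | d t x < δ} ∩ Metric.ball y s) ≤
              ENNReal.ofReal (C₀ * δ ^ 2 * s)) ∧
          (∀ t ∈ Set.Ioo (T - ρ ^ 2) T, ∀ x ∈ Metric.ball x₀ ρ, |α t x| ≤ M ∧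
            inner ℝ (Literature.Analysis.FluidPDE.curl (u t) x) (gradient (α t) x) = 0 ∧
            (0 < d t x → ‖Literature.Analysis.FluidPDE.curl (u t) x‖ * d t x ≤ C₀ * ‖gradient (α t) x‖ ∧
              ‖b t x‖ * d t x ≤ C₀ ∧
              deriv (fun s => α s x) t + Literature.Analysis.FluidPDE.convect (u t) (α t) x =
                ν * (Laplacian.laplacian (α t) x + inner ℝ (b t x) (gradient (α t) x))))) →
        -- the Dirichlet (D1) clauses: `α ≥ 0`, `α = 0` on the degeneracy set, `α` smooth below `T`
        (∀ t ∈ Set.Ioo (T - ρ ^ 2) T, ∀ x ∈ Metric.ball x₀ ρ, 0 ≤ α t x ∧ (d t x = 0 → α t x = 0)) →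
        ContDiffOn ℝ ((⊤ : ℕ∞) : WithTop ℕ∞) (Function.uncurry α) (Set.Ioo (T - ρ ^ 2) T ×ˢ Metric.ball x₀ ρ) →
        -- `d ≥ 0` is the distance to its own zero set, which is the fixed straight line through the vertex
        -- parallel to `e₂`, and `d` is `1`-Lipschitz
        (∀ (t : ℝ) (x : EuclideanSpace ℝ (Fin 3)),
          0 ≤ d t x ∧ d t x = Metric.infDist x {y | d t y = 0} ∧ d t x = d 0 x) →
        (∀ t : ℝ, {y : EuclideanSpace ℝ (Fin 3) | d t y = 0} = {y | y 0 = x₀ 0 ∧ y 1 = x₀ 1}) →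
        (∀ t : ℝ, d t x₀ = 0) →
        (∀ (t : ℝ) (x y : EuclideanSpace ℝ (Fin 3)), |d t x - d t y| ≤ dist x y) →
        ∃ ρ₂ : ℝ, 0 < ρ₂ ∧ ρ₂ ≤ ρ ∧
          (∀ ε : ℝ, 0 < ε → ∃ η : ℝ, 0 < η ∧
            ∀ t ∈ Set.Ioo (T - ρ₂ ^ 2) T, ∀ s ∈ Set.Ioo (T - ρ₂ ^ 2) T, ∀ x ∈ Metric.ball x₀ ρ₂,
              ∀ y ∈ Metric.ball x₀ ρ₂, |t - s| ≤ η → dist x y ≤ η → |α t x - α s y| ≤ ε)) := by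
  intro H
  obtain ⟨b, hG, hDir⟩ := restState_dirichletAxisGauge (c := 1) (ν := 1) (T := 2) (ρ := 1) one_pos le_rfl
    one_pos one_pos (by norm_num)
  have h := H 1 2 one_pos two_pos 0 0 (isClassicalNSSolutionOn_zero _ _) (isLerayHopfOn_zero _ _)
    EulerProximatePump.Negative.hasRapidSpatialDecay_zero 0 1 8 (1 + 1 ^ 2)
    (fun t y => 1 * ((y 0 ^ 2 + y 1 ^ 2) / ((1 * (2 - t)) ^ 2 + (y 0 ^ 2 + y 1 ^ 2))) + (y 0 ^ 2 + y 1 ^ 2)) b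
    (fun _ x => cylRadius x) hG (fun t _ x _ => hDir t x) (contDiffOn_dipMomentum 1 one_pos)
    (fun t x => ⟨cylRadius_nonneg x, cylRadius_eq_infDist x, rfl⟩)
    (fun _ => Set.ext fun y => by simpa using cylRadius_eq_zero_iff y)
    (fun _ => (cylRadius_eq_zero_iff 0).2 ⟨rfl, rfl⟩)
    (fun _ x y => abs_cylRadius_sub_cylRadius_le x y)
  exact not_uniformlyContinuous_collapsingDip (c := 1) (ν := 1) (T := 2) (ρ := 1) one_pos one_pos h

end Summit.NavierStokesRegularity.NavierStokesRegularity.Theorems.CriticalSwirlRegularity.Negative
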